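import Literature.Analysis.FluidPDE.NormalisedPressureL2Bound
import Literature.Analysis.FluidPDE.LocalPressureFarFieldTools
import HarnessLib

/-!
# Kernel toolkit for the Liouville step of the local pressure estimate of local Leray solutions
on a slab: the regularised Newtonian kernel `Φ_δ`, its third derivative, and parametric
integrals against uniformly locally square-integrable fields

Analysis/FluidPDE support file (theorems only, everything PROVED) on the discharge path of the
named fact `Literature.Analysis.FluidPDE.kangMiuraTsai_local_pressure_bound`
(`LocalLerayPressureBound.lean`; Kang–Miura–Tsai, IMRN 2021 = arXiv:1812.10509, the bound
`‖p̄_{x₀,R}‖_{L^s L^q(B×(0,T))} ≤ c(T,R,s,q) A` printed in the proof of Lemma 3.4, §8). As recorded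
in the module docstring of that file, the bound follows from a *representation of the pressure
gradient* of a local Leray solution `(v, π)` on the slab, which in turn rests on a Liouville
argument for harmonic functions (Fernández-Dalgo–Lemarié-Rieusset, DCDS-S 14 (2021), Thm. 1 and
§5; Lemarié-Rieusset, *The Navier–Stokes problem in the 21st century*, §6.3). The tree's route
mollifies in space with the smooth radial bump `λ_δ = ΔΦ_δ` of unit mass, `Φ_δ = newtonReg δ` the
regularised Newtonian kernel of `NormalisedPressureL2Bound.lean` (`Φ_δ = Γ = -1/(4π|z|)` off the
ball of radius `δ`), so that every Newtonian potential that occurs is an explicit smooth function: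
the potential of `λ_δ` is `Φ_δ` itself, and the kernel paired with `v ⊗ v` is the third
derivative `D³Φ_δ`, which decays like `|z|⁻⁴`. This file supplies the kernel-side facts:

* `exists_norm_fderiv3_newtonReg_le_inv` — **global decay of `D³Φ_δ`**:
  `‖D³Φ_δ(z)‖ ≤ C ((1 + |z|)⁴)⁻¹` for all `z` (bounded near the origin, `= D³Γ = O(|z|⁻⁴)` off
  the ball; `exists_norm_fderiv3_newtonKernel_le`);
* `exists_lintegral_mul_inv_one_add_norm_pow_le` — **uniformly local `L²` fields integrate
  against `(1 + |y - x₀|)⁻⁴`**: `∫ g(y) (1+|y-x₀|)⁻⁴ dy ≤ C A` whenever `∫_{B_1(z)} g ≤ A` for all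
  centres `z` (`lintegral_mul_le_of_forall_lintegral_ball_le` with the comparison
  `(1+|y-x₀|)⁻⁴ ≤ 16 (1+|z-x₀|)⁻⁴` for `|z-y| < 1`, and `∫ (1+|z|)⁻⁴ dz < ∞` in `ℝ³`,
  Mathlib's `finite_integral_one_add_norm`);
* `continuous_integral_evalDiag_fderiv3_newtonReg` — continuity of the pairing
  `c ↦ ∫ D³Φ_δ(y - c)(e)(w y, w y) dy` for a uniformly locally `L²` field `w`;
* `hasFDerivAt_integral_evalDiag_fderiv2_newtonReg_sub` — **the renormalised potential**
  `𝒢(c) = ∫ (D²Φ_δ(y - c) - D²Φ_δ(y - x₀))(w y, w y) dy` is differentiable with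
  `∂_e 𝒢(c) = -∫ D³Φ_δ(y - c)(e)(w y, w y) dy` (differentiation under the integral sign; the
  un-renormalised potential diverges logarithmically for a merely uniformly local field);
* pointwise conversions between the operator forms `D²Φ_δ(z)(a,a)`, `D³Φ_δ(z)(e)(a,a)` and the
  pure/directional derivatives `∂ₐ∂ₐΦ_δ`, `∂ₑ∂ₐ∂ₐΦ_δ` used by the tree's Calderón–Zygmund bound
  `exists_eLpNorm_hessConv_le_of_bdd`, and the identification of `D²Φ_δ` with `-K` (the
  pressure kernel `pressureKernel`) off the ball of radius `δ`, in the two-centre form of the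
  far field of the local pressure expansion (`localPressureFar`).

No Navier–Stokes input occurs here; the solution enters in the sibling files.

## Mathlib / tree search

Tree: `newtonReg`, `newtonReg_eq_newtonFar`, `contDiff_newtonReg`,
`newtonReg_eventuallyEq_newtonKernel`, `fderiv_fderiv_newtonReg_apply_eq_neg_pressureKernel`
(`NormalisedPressureL2Bound`); `exists_bounds_fderiv2_newtonFar`, `evalDiag`, `norm_evalDiag_le`
(`PressureRepresentation`); `exists_norm_fderiv3_newtonKernel_le`,
`lintegral_mul_le_of_forall_lintegral_ball_le` (`LocalPressureFarFieldTools`);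
`radialCutoff_radial`, `newtonKernel` (`NewtonKernel`); `laplacian_comp_const_sub`
(`HarmonicProbe`). Mathlib: `hasFDerivAt_integral_of_dominated_of_fderiv_le`,
`continuousAt_of_dominated`, `finite_integral_one_add_norm`, `lintegral_sub_right_eq_self`,
`Convex.norm_image_sub_le_of_norm_fderiv_le`.

## References

* P. G. Fernández-Dalgo, P. G. Lemarié-Rieusset, *Characterisation of the pressure term in the
  incompressible Navier–Stokes equations on the whole space*, DCDS-S 14 (2021) 2917–2931
  = arXiv:2001.10436, Thm. 1 and §5. [`FernandezdalgoLemarierieusset2021`]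
* K. Kang, H. Miura, T.-P. Tsai, IMRN 2021 = arXiv:1812.10509, Lemma 3.4 and §8.
  [`KangMiuraTsai2020`]
-/

noncomputable section

open MeasureTheory Set Filter Topology Function Metric
open scoped ENNReal NNReal RealInnerProductSpace Laplacian

namespace Literature.Analysis.FluidPDE


-- nested operator types `ℝ³ →L[ℝ] ℝ³ →L[ℝ] ℝ³ →L[ℝ] ℝ`
set_option maxSynthPendingDepth 3

/-! ## The regularised kernel: smoothness, bounds, decay of `D³Φ_δ` -/

section Kernel

variable {δ : ℝ}

/-- `D²Φ_δ ∈ C²`. [folklore] -/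
theorem contDiff_fderiv2_newtonReg (δ : ℝ) :
    ContDiff ℝ 2 (fderiv ℝ (fderiv ℝ (newtonReg δ))) :=
  ((contDiff_newtonReg δ (n := 4)).fderiv_right (m := 3) (by norm_num)).fderiv_right
    (m := 2) (by norm_num)

/-- `D³Φ_δ ∈ C¹`. [folklore] -/
theorem contDiff_fderiv3_newtonReg (δ : ℝ) :
    ContDiff ℝ 1 (fderiv ℝ (fderiv ℝ (fderiv ℝ (newtonReg δ)))) :=
  (contDiff_fderiv2_newtonReg δ).fderiv_right (m := 1) (by norm_num)

/-- `D³Φ_δ` is continuous. [folklore] -/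
theorem continuous_fderiv3_newtonReg (δ : ℝ) :
    Continuous (fderiv ℝ (fderiv ℝ (fderiv ℝ (newtonReg δ)))) :=
  (contDiff_fderiv3_newtonReg δ).continuous

/-- Global bounds for `D²Φ_δ`, `D³Φ_δ`, `D⁴Φ_δ` (`δ > 0`). [folklore] -/
theorem exists_bounds_fderiv2_newtonReg (hδ : 0 < δ) :
    ∃ M₀ M₁ M₂ : ℝ, (∀ z, ‖fderiv ℝ (fderiv ℝ (newtonReg δ)) z‖ ≤ M₀) ∧
      (∀ z, ‖fderiv ℝ (fderiv ℝ (fderiv ℝ (newtonReg δ))) z‖ ≤ M₁) ∧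
      (∀ z, ‖fderiv ℝ (fderiv ℝ (fderiv ℝ (fderiv ℝ (newtonReg δ)))) z‖ ≤ M₂) := by
  rw [newtonReg_eq_newtonFar hδ]
  exact exists_bounds_fderiv2_newtonFar (half_pos_lt hδ).1 (half_pos_lt hδ).2

/-- Off the closed ball of radius `δ`, `D³Φ_δ = D³Γ`. [folklore] -/
theorem fderiv3_newtonReg_eq_of_lt (hδ : 0 < δ) {z : (EuclideanSpace ℝ (Fin 3))} (hz : δ < ‖z‖) :
    fderiv ℝ (fderiv ℝ (fderiv ℝ (newtonReg δ))) z =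
      fderiv ℝ (fderiv ℝ (fderiv ℝ newtonKernel)) z :=
  ((newtonReg_eventuallyEq_newtonKernel hδ hz).fderiv.fderiv.fderiv).eq_of_nhds

/-- Off the closed ball of radius `δ`, `D²Φ_δ = D²Γ`. [folklore] -/
theorem fderiv2_newtonReg_eq_of_lt (hδ : 0 < δ) {z : (EuclideanSpace ℝ (Fin 3))} (hz : δ < ‖z‖) :
    fderiv ℝ (fderiv ℝ (newtonReg δ)) z = fderiv ℝ (fderiv ℝ newtonKernel) z :=
  ((newtonReg_eventuallyEq_newtonKernel hδ hz).fderiv.fderiv).eq_of_nhds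

/-- `((1 + a)⁴)⁻¹ ≤ (1 + b)⁴ ((1 + c)⁴)⁻¹` whenever `0 ≤ a`, `0 ≤ c` and `1 + c ≤ (1 + b)(1 + a)`:
the elementary comparison used to pass between the weights at two nearby centres. [folklore] -/
theorem inv_one_add_pow_le_mul {a b c : ℝ} (ha : 0 ≤ a) (hc : 0 ≤ c)
    (h : 1 + c ≤ (1 + b) * (1 + a)) :
    ((1 + a) ^ 4)⁻¹ ≤ (1 + b) ^ 4 * ((1 + c) ^ 4)⁻¹ := by
  have ha' : 0 < 1 + a := by linarith
  have hc' : 0 < 1 + c := by linarith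
  have key : (1 + c) ^ 4 ≤ ((1 + b) * (1 + a)) ^ 4 := pow_le_pow_left₀ hc'.le h 4
  rw [mul_pow] at key
  rw [inv_eq_one_div, ← div_eq_mul_inv, div_le_div_iff₀ (by positivity) (by positivity), one_mul]
  exact key

/-- **Global decay of `D³Φ_δ`:** there is `C = C(δ) ≥ 0` with `‖D³Φ_δ(z)‖ ≤ C ((1+|z|)⁴)⁻¹` for
every `z` (inside the ball of radius `δ` the smooth kernel is bounded; outside,
`D³Φ_δ = D³Γ = O(|z|⁻⁴)`). [folklore] -/
theorem exists_norm_fderiv3_newtonReg_le_inv (hδ : 0 < δ) :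
    ∃ C : ℝ, 0 ≤ C ∧ ∀ z : (EuclideanSpace ℝ (Fin 3)),
      ‖fderiv ℝ (fderiv ℝ (fderiv ℝ (newtonReg δ))) z‖ ≤ C * ((1 + ‖z‖) ^ 4)⁻¹ := by
  obtain ⟨M₀, M₁, M₂, -, hM₁, -⟩ := exists_bounds_fderiv2_newtonReg hδ
  obtain ⟨M₃, hM₃0, hM₃⟩ := exists_norm_fderiv3_newtonKernel_le
  have hM₁0 : 0 ≤ M₁ := (norm_nonneg _).trans (hM₁ 0)
  set C : ℝ := M₁ * (1 + δ) ^ 4 + M₃ * ((1 + δ) / δ) ^ 4 with hC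
  have hC1 : 0 ≤ M₁ * (1 + δ) ^ 4 := by positivity
  have hC2 : 0 ≤ M₃ * ((1 + δ) / δ) ^ 4 := by positivity
  refine ⟨C, by positivity, fun z => ?_⟩
  have hw : 0 < ((1 + ‖z‖) ^ 4)⁻¹ := by positivity
  rcases le_or_gt ‖z‖ δ with hz | hz
  · -- inside: `M₁ ≤ M₁ (1+δ)⁴ (1+|z|)⁻⁴`
    have h1 : ((1 + (0 : ℝ)) ^ 4)⁻¹ ≤ (1 + δ) ^ 4 * ((1 + ‖z‖) ^ 4)⁻¹ :=
      inv_one_add_pow_le_mul le_rfl (norm_nonneg z) (by nlinarith [norm_nonneg z])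
    rw [add_zero, one_pow, inv_one] at h1
    calc ‖fderiv ℝ (fderiv ℝ (fderiv ℝ (newtonReg δ))) z‖ ≤ M₁ * 1 := by rw [mul_one]; exact hM₁ z
      _ ≤ M₁ * ((1 + δ) ^ 4 * ((1 + ‖z‖) ^ 4)⁻¹) := mul_le_mul_of_nonneg_left h1 hM₁0
      _ = M₁ * (1 + δ) ^ 4 * ((1 + ‖z‖) ^ 4)⁻¹ := by ring
      _ ≤ C * ((1 + ‖z‖) ^ 4)⁻¹ := by
          rw [hC, add_mul]
          exact le_add_of_nonneg_right (mul_nonneg hC2 hw.le)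
  · -- outside: `M₃/|z|⁴ ≤ M₃ ((1+δ)/δ)⁴ (1+|z|)⁻⁴`
    have hz0 : z ≠ 0 := by
      rintro rfl
      rw [norm_zero] at hz
      linarith
    have hzpos : 0 < ‖z‖ := hδ.trans hz
    rw [fderiv3_newtonReg_eq_of_lt hδ hz]
    have h1 : 1 + ‖z‖ ≤ (1 + δ) / δ * ‖z‖ := by
      rw [div_mul_eq_mul_div, le_div_iff₀ hδ]
      nlinarith
    have h2 : (1 + ‖z‖) ^ 4 ≤ ((1 + δ) / δ * ‖z‖) ^ 4 := pow_le_pow_left₀ (by positivity) h1 4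
    have key : M₃ / ‖z‖ ^ 4 ≤ M₃ * ((1 + δ) / δ) ^ 4 * ((1 + ‖z‖) ^ 4)⁻¹ := by
      rw [mul_assoc, div_eq_mul_inv M₃]
      refine mul_le_mul_of_nonneg_left ?_ hM₃0
      rw [inv_eq_one_div, ← div_eq_mul_inv, div_le_div_iff₀ (by positivity) (by positivity),
        one_mul, ← mul_pow]
      exact h2
    calc ‖fderiv ℝ (fderiv ℝ (fderiv ℝ newtonKernel)) z‖ ≤ M₃ / ‖z‖ ^ 4 := hM₃ z hz0
      _ ≤ M₃ * ((1 + δ) / δ) ^ 4 * ((1 + ‖z‖) ^ 4)⁻¹ := key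
      _ ≤ C * ((1 + ‖z‖) ^ 4)⁻¹ := by
          rw [hC, add_mul]
          exact le_add_of_nonneg_left (mul_nonneg hC1 hw.le)

/-- The weights at two centres at distance `< 1` (or `≤ 1`) compare by a factor `16`:
`((1 + |y - x₀|)⁴)⁻¹ ≤ 16 ((1 + |z - x₀|)⁴)⁻¹` if `|z - y| ≤ 1`. [folklore] -/
theorem inv_one_add_norm_pow_le_of_dist_le {x₀ y z : (EuclideanSpace ℝ (Fin 3))} (h : dist z y ≤ 1) :
    ((1 + ‖y - x₀‖) ^ 4)⁻¹ ≤ 16 * ((1 + ‖z - x₀‖) ^ 4)⁻¹ := by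
  have h1 : 1 + ‖z - x₀‖ ≤ (1 + 1) * (1 + ‖y - x₀‖) := by
    have : ‖z - x₀‖ ≤ ‖z - y‖ + ‖y - x₀‖ := norm_sub_le_norm_sub_add_norm_sub z y x₀
    rw [dist_eq_norm] at h
    nlinarith [norm_nonneg (y - x₀)]
  have := inv_one_add_pow_le_mul (norm_nonneg (y - x₀)) (norm_nonneg (z - x₀)) h1
  norm_num at this
  linarith

end Kernel

/-! ## Uniformly local `L²` fields against the weight `(1 + |y - x₀|)⁻⁴` -/

section Uloc

/-- `∫ (1 + |z|)⁻⁴ dz < ∞` in `ℝ³` (Mathlib's `finite_integral_one_add_norm`, exponent `4 > 3`).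
[folklore] -/
theorem lintegral_inv_one_add_norm_pow_lt_top :
    ∫⁻ z : (EuclideanSpace ℝ (Fin 3)), ENNReal.ofReal (((1 + ‖z‖) ^ 4)⁻¹) < ⊤ := by
  have h := finite_integral_one_add_norm (E := (EuclideanSpace ℝ (Fin 3))) (μ := volume) (r := 4)
    (by rw [finrank_euclideanSpace, Fintype.card_fin]; norm_num)
  refine lt_of_le_of_lt (le_of_eq (lintegral_congr fun z => ?_)) h
  congr 1
  rw [Real.rpow_neg (by positivity), show (4 : ℝ) = ((4 : ℕ) : ℝ) by norm_num, Real.rpow_natCast]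

/-- The weight `y ↦ (1 + |y - x₀|)⁻⁴` is measurable (as an `ℝ≥0∞`-valued function). [folklore] -/
theorem measurable_ofReal_inv_one_add_norm_sub_pow (x₀ : (EuclideanSpace ℝ (Fin 3))) :
    Measurable fun y : (EuclideanSpace ℝ (Fin 3)) => ENNReal.ofReal (((1 + ‖y - x₀‖) ^ 4)⁻¹) := by
  fun_prop

/-- **Uniformly local integrals against `(1 + |y - x₀|)⁻⁴`.** There is a finite constant `C`
(`= 16 |B_1|⁻¹ ∫ (1+|z|)⁻⁴ dz`) such that for every a.e.-measurable `g ≥ 0` on `ℝ³` whose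
integrals over unit balls are `≤ A` and every centre `x₀`,
`∫ g(y) (1 + |y - x₀|)⁻⁴ dy ≤ C A`. [folklore] -/
theorem exists_lintegral_mul_inv_one_add_norm_pow_le :
    ∃ C : ℝ≥0∞, C ≠ ⊤ ∧ ∀ (g : (EuclideanSpace ℝ (Fin 3)) → ℝ≥0∞), AEMeasurable g volume → ∀ (A : ℝ≥0∞),
      (∀ z : (EuclideanSpace ℝ (Fin 3)), ∫⁻ y in ball z 1, g y ≤ A) → ∀ x₀ : (EuclideanSpace ℝ (Fin 3)),
        ∫⁻ y, g y * ENNReal.ofReal (((1 + ‖y - x₀‖) ^ 4)⁻¹) ≤ C * A := by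
  set I : ℝ≥0∞ := ∫⁻ z : (EuclideanSpace ℝ (Fin 3)), ENNReal.ofReal (((1 + ‖z‖) ^ 4)⁻¹) with hI
  set V : ℝ≥0∞ := volume (ball (0 : (EuclideanSpace ℝ (Fin 3))) 1) with hV
  have hV0 : V ≠ 0 := (measure_ball_pos volume _ one_pos).ne'
  refine ⟨V⁻¹ * (16 * I), ?_, fun g hg A hA x₀ => ?_⟩
  · exact ENNReal.mul_ne_top (ENNReal.inv_ne_top.2 hV0)
      (ENNReal.mul_ne_top (by norm_num) lintegral_inv_one_add_norm_pow_lt_top.ne)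
  set W : (EuclideanSpace ℝ (Fin 3)) → ℝ≥0∞ := fun y => ENNReal.ofReal (((1 + ‖y - x₀‖) ^ 4)⁻¹) with hW
  set w : (EuclideanSpace ℝ (Fin 3)) → ℝ≥0∞ := fun z => 16 * ENNReal.ofReal (((1 + ‖z - x₀‖) ^ 4)⁻¹) with hw
  have hwm : AEMeasurable w volume :=
    ((measurable_ofReal_inv_one_add_norm_sub_pow x₀).const_mul 16).aemeasurable
  have hWw : ∀ y z : (EuclideanSpace ℝ (Fin 3)), dist z y < 1 → W y ≤ w z := by
    intro y z hzy
    rw [hW, hw]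
    dsimp only
    rw [show (16 : ℝ≥0∞) = ENNReal.ofReal 16 by norm_num, ← ENNReal.ofReal_mul (by norm_num)]
    exact ENNReal.ofReal_le_ofReal (inv_one_add_norm_pow_le_of_dist_le hzy.le)
  have hint : ∫⁻ z, w z = 16 * I := by
    rw [hw, lintegral_const_mul' _ _ (by norm_num), hI]
    congr 1
    exact lintegral_sub_right_eq_self (fun z : (EuclideanSpace ℝ (Fin 3)) => ENNReal.ofReal (((1 + ‖z‖) ^ 4)⁻¹)) x₀
  calc ∫⁻ y, g y * W y ≤ V⁻¹ * (A * ∫⁻ z, w z) :=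
        lintegral_mul_le_of_forall_lintegral_ball_le hg hwm hA hWw
    _ = V⁻¹ * (16 * I) * A := by rw [hint]; ring

/-- **Integrability against a uniformly local `L²` field.** For an a.e.-strongly measurable
field `w` with `∫_{B_1(z)} |w|² ≤ A < ∞` for all `z`, the function `(1+|y-x₀|)⁻⁴ |w(y)|²` is
integrable and its integral is at most `(C A).toReal`, `C` the constant of
`exists_lintegral_mul_inv_one_add_norm_pow_le`. [folklore] -/
theorem integrable_inv_one_add_norm_pow_mul_norm_sq {C : ℝ≥0∞} (hCtop : C ≠ ⊤)
    (hC : ∀ (g : (EuclideanSpace ℝ (Fin 3)) → ℝ≥0∞), AEMeasurable g volume → ∀ (A : ℝ≥0∞),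
      (∀ z : (EuclideanSpace ℝ (Fin 3)), ∫⁻ y in ball z 1, g y ≤ A) → ∀ x₀ : (EuclideanSpace ℝ (Fin 3)),
        ∫⁻ y, g y * ENNReal.ofReal (((1 + ‖y - x₀‖) ^ 4)⁻¹) ≤ C * A)
    {w : (EuclideanSpace ℝ (Fin 3)) → (EuclideanSpace ℝ (Fin 3))} (hw : AEStronglyMeasurable w volume) {A : ℝ≥0∞} (hAtop : A ≠ ⊤)
    (hA : ∀ z : (EuclideanSpace ℝ (Fin 3)), ∫⁻ y in ball z 1, ‖w y‖ₑ ^ 2 ≤ A) (x₀ : (EuclideanSpace ℝ (Fin 3))) :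
    Integrable (fun y => ((1 + ‖y - x₀‖) ^ 4)⁻¹ * ‖w y‖ ^ 2) volume ∧
      ∫ y, ((1 + ‖y - x₀‖) ^ 4)⁻¹ * ‖w y‖ ^ 2 ≤ (C * A).toReal := by
  have hm : AEStronglyMeasurable (fun y => ((1 + ‖y - x₀‖) ^ 4)⁻¹ * ‖w y‖ ^ 2) volume := by
    refine AEStronglyMeasurable.mul ?_ ((continuous_norm.pow 2).comp_aestronglyMeasurable hw)
    exact (Measurable.aestronglyMeasurable (by fun_prop))
  have hnn : ∀ y, 0 ≤ ((1 + ‖y - x₀‖) ^ 4)⁻¹ * ‖w y‖ ^ 2 := fun y => by positivity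
  have key : ∫⁻ y, ENNReal.ofReal (((1 + ‖y - x₀‖) ^ 4)⁻¹ * ‖w y‖ ^ 2) ≤ C * A := by
    have h := hC (fun y => ‖w y‖ₑ ^ 2) (hw.enorm.pow_const 2) A hA x₀
    refine le_trans (le_of_eq (lintegral_congr fun y => ?_)) h
    rw [ENNReal.ofReal_mul (by positivity), mul_comm, ← ofReal_norm,
      ← ENNReal.ofReal_pow (norm_nonneg _)]
  have hlt : ∫⁻ y, ENNReal.ofReal (((1 + ‖y - x₀‖) ^ 4)⁻¹ * ‖w y‖ ^ 2) < ⊤ :=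
    lt_of_le_of_lt key (ENNReal.mul_lt_top hCtop.lt_top hAtop.lt_top)
  have hint : Integrable (fun y => ((1 + ‖y - x₀‖) ^ 4)⁻¹ * ‖w y‖ ^ 2) volume := by
    refine ⟨hm, ?_⟩
    rw [hasFiniteIntegral_iff_ofReal (Eventually.of_forall hnn)]
    exact hlt
  refine ⟨hint, ?_⟩
  rw [integral_eq_lintegral_of_nonneg_ae (Eventually.of_forall hnn) hm]
  exact ENNReal.toReal_mono (ENNReal.mul_ne_top hCtop hAtop) key

end Uloc

/-! ## Parametric integrals of `D²Φ_δ`, `D³Φ_δ` against uniformly local `L²` fields -/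

section Parametric

variable {δ : ℝ} {w : (EuclideanSpace ℝ (Fin 3)) → (EuclideanSpace ℝ (Fin 3))} {A : ℝ≥0∞}

/-- Measurability of the weights `y ↦ evalDiag (w y)` for an a.e.-strongly measurable field.
[folklore] -/
theorem aestronglyMeasurable_evalDiag_comp (hw : AEStronglyMeasurable w volume) :
    AEStronglyMeasurable (fun y => evalDiag (w y)) volume :=
  continuous_evalDiag.comp_aestronglyMeasurable hw

/-- Measurability of `y ↦ K(y)(w y, w y)` for an a.e.-strongly measurable field `w` and an
a.e.-strongly measurable bilinear-form-valued kernel `K`. [folklore] -/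
theorem aestronglyMeasurable_evalDiag_apply (hw : AEStronglyMeasurable w volume)
    {K : (EuclideanSpace ℝ (Fin 3)) → (EuclideanSpace ℝ (Fin 3)) →L[ℝ] (EuclideanSpace ℝ (Fin 3)) →L[ℝ] ℝ} (hK : AEStronglyMeasurable K volume) :
    AEStronglyMeasurable (fun y => evalDiag (w y) (K y)) volume := by
  have h1 : Continuous fun p : (EuclideanSpace ℝ (Fin 3)) × ((EuclideanSpace ℝ (Fin 3)) →L[ℝ] (EuclideanSpace ℝ (Fin 3)) →L[ℝ] ℝ) => p.2 p.1 :=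
    isBoundedBilinearMap_apply.continuous.comp (continuous_snd.prodMk continuous_fst)
  have hΨ : Continuous fun p : (EuclideanSpace ℝ (Fin 3)) × ((EuclideanSpace ℝ (Fin 3)) →L[ℝ] (EuclideanSpace ℝ (Fin 3)) →L[ℝ] ℝ) => p.2 p.1 p.1 :=
    isBoundedBilinearMap_apply.continuous.comp (h1.prodMk continuous_fst)
  exact hΨ.comp_aestronglyMeasurable (hw.prodMk hK)

/-- Measurability of `y ↦ evalDiag(w y) ∘ K(y)` for an a.e.-strongly measurable field `w` and an
a.e.-strongly measurable trilinear-form-valued kernel `K`. [folklore] -/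
theorem aestronglyMeasurable_evalDiag_comp_clm (hw : AEStronglyMeasurable w volume)
    {K : (EuclideanSpace ℝ (Fin 3)) → (EuclideanSpace ℝ (Fin 3)) →L[ℝ] (EuclideanSpace ℝ (Fin 3)) →L[ℝ] (EuclideanSpace ℝ (Fin 3)) →L[ℝ] ℝ} (hK : AEStronglyMeasurable K volume) :
    AEStronglyMeasurable (fun y => (evalDiag (w y)).comp (K y)) volume := by
  have hΨ : Continuous fun p : (((EuclideanSpace ℝ (Fin 3)) →L[ℝ] (EuclideanSpace ℝ (Fin 3)) →L[ℝ] ℝ) →L[ℝ] ℝ) ×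
      ((EuclideanSpace ℝ (Fin 3)) →L[ℝ] (EuclideanSpace ℝ (Fin 3)) →L[ℝ] (EuclideanSpace ℝ (Fin 3)) →L[ℝ] ℝ) => p.1.comp p.2 :=
    (ContinuousLinearMap.compL ℝ (EuclideanSpace ℝ (Fin 3)) ((EuclideanSpace ℝ (Fin 3)) →L[ℝ] (EuclideanSpace ℝ (Fin 3)) →L[ℝ] ℝ) ℝ).continuous₂
  exact hΨ.comp_aestronglyMeasurable ((aestronglyMeasurable_evalDiag_comp hw).prodMk hK)

/-- The comparison of weights along a segment: for `p ∈ [x₀ - y, c - y]`,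
`((1 + |p|)⁴)⁻¹ ≤ (1 + |c - x₀|)⁴ ((1 + |y - x₀|)⁴)⁻¹`. [folklore] -/
theorem inv_one_add_norm_pow_le_of_mem_segment {x₀ c y p : (EuclideanSpace ℝ (Fin 3))}
    (hp : p ∈ segment ℝ (x₀ - y) (c - y)) :
    ((1 + ‖p‖) ^ 4)⁻¹ ≤ (1 + ‖c - x₀‖) ^ 4 * ((1 + ‖y - x₀‖) ^ 4)⁻¹ := by
  rw [segment_eq_image'] at hp
  obtain ⟨θ, hθ, rfl⟩ := hp
  have hθ0 : 0 ≤ θ := hθ.1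
  have hθ1 : θ ≤ 1 := hθ.2
  have e1 : (c - y) - (x₀ - y) = c - x₀ := by abel
  rw [e1]
  refine inv_one_add_pow_le_mul (norm_nonneg _) (norm_nonneg _) ?_
  have hB := norm_nonneg (c - x₀)
  have h1 : ‖y - x₀‖ ≤ ‖x₀ - y + θ • (c - x₀)‖ + ‖c - x₀‖ := by
    have e2 : x₀ - y = (x₀ - y + θ • (c - x₀)) - θ • (c - x₀) := by abel
    calc ‖y - x₀‖ = ‖x₀ - y‖ := norm_sub_rev _ _
      _ = ‖(x₀ - y + θ • (c - x₀)) - θ • (c - x₀)‖ := by rw [← e2]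
      _ ≤ ‖x₀ - y + θ • (c - x₀)‖ + ‖θ • (c - x₀)‖ := norm_sub_le _ _
      _ ≤ ‖x₀ - y + θ • (c - x₀)‖ + ‖c - x₀‖ := by
          rw [norm_smul, Real.norm_eq_abs, abs_of_nonneg hθ0]
          nlinarith
  nlinarith [norm_nonneg (x₀ - y + θ • (c - x₀))]

/-- **Two-centre bound for `D²Φ_δ` by the mean value theorem:**
`‖D²Φ_δ(c - y) - D²Φ_δ(x₀ - y)‖ ≤ C |c - x₀| (1 + |c - x₀|)⁴ ((1 + |y - x₀|)⁴)⁻¹`, with `C` the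
decay constant of `D³Φ_δ` (`exists_norm_fderiv3_newtonReg_le_inv`). [folklore] -/
theorem norm_fderiv2_newtonReg_sub_sub_le {C : ℝ} (hC0 : 0 ≤ C)
    (hC : ∀ z : (EuclideanSpace ℝ (Fin 3)), ‖fderiv ℝ (fderiv ℝ (fderiv ℝ (newtonReg δ))) z‖ ≤ C * ((1 + ‖z‖) ^ 4)⁻¹)
    (x₀ c y : (EuclideanSpace ℝ (Fin 3))) :
    ‖fderiv ℝ (fderiv ℝ (newtonReg δ)) (c - y) - fderiv ℝ (fderiv ℝ (newtonReg δ)) (x₀ - y)‖ ≤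
      C * ‖c - x₀‖ * (1 + ‖c - x₀‖) ^ 4 * ((1 + ‖y - x₀‖) ^ 4)⁻¹ := by
  have hd : ∀ p ∈ segment ℝ (x₀ - y) (c - y),
      DifferentiableAt ℝ (fderiv ℝ (fderiv ℝ (newtonReg δ))) p := fun p _ =>
    ((contDiff_fderiv2_newtonReg δ).differentiable (by norm_num)) p
  have hb : ∀ p ∈ segment ℝ (x₀ - y) (c - y),
      ‖fderiv ℝ (fderiv ℝ (fderiv ℝ (newtonReg δ))) p‖ ≤
        C * ((1 + ‖c - x₀‖) ^ 4 * ((1 + ‖y - x₀‖) ^ 4)⁻¹) := fun p hp =>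
    (hC p).trans (mul_le_mul_of_nonneg_left (inv_one_add_norm_pow_le_of_mem_segment hp) hC0)
  have key := (convex_segment (x₀ - y) (c - y)).norm_image_sub_le_of_norm_fderiv_le hd hb
    (left_mem_segment ℝ _ _) (right_mem_segment ℝ _ _)
  have e1 : (c - y) - (x₀ - y) = c - x₀ := by abel
  rw [e1] at key
  calc _ ≤ C * ((1 + ‖c - x₀‖) ^ 4 * ((1 + ‖y - x₀‖) ^ 4)⁻¹) * ‖c - x₀‖ := key
    _ = C * ‖c - x₀‖ * (1 + ‖c - x₀‖) ^ 4 * ((1 + ‖y - x₀‖) ^ 4)⁻¹ := by ring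

variable (hδ : 0 < δ) (hw : AEStronglyMeasurable w volume) (hAtop : A ≠ ⊤)
  (hA : ∀ z : (EuclideanSpace ℝ (Fin 3)), ∫⁻ y in ball z 1, ‖w y‖ₑ ^ 2 ≤ A)

include hδ hw hAtop hA

/-- **Integrability of the `D³Φ_δ`-pairing**: `y ↦ D³Φ_δ(c - y)(e)(w y, w y)` is integrable for a
uniformly locally `L²` field `w` (decay `O(|z|⁻⁴)` of the kernel), with the bound
`∫ |D³Φ_δ(c - y)(e)(w y, w y)| dy ≤ C_δ |e| (C_w A).toReal`. [folklore] -/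
theorem integrable_evalDiag_fderiv3_newtonReg (c e : (EuclideanSpace ℝ (Fin 3))) :
    Integrable (fun y => evalDiag (w y)
      (fderiv ℝ (fderiv ℝ (fderiv ℝ (newtonReg δ))) (c - y) e)) volume := by
  obtain ⟨Cw, hCwtop, hCw⟩ := exists_lintegral_mul_inv_one_add_norm_pow_le
  obtain ⟨C, hC0, hC⟩ := exists_norm_fderiv3_newtonReg_le_inv hδ
  obtain ⟨hint, -⟩ := integrable_inv_one_add_norm_pow_mul_norm_sq hCwtop hCw hw hAtop hA c
  refine Integrable.mono' (hint.const_mul (C * ‖e‖)) ?_ (Eventually.of_forall fun y => ?_)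
  · exact aestronglyMeasurable_evalDiag_apply hw
      (((continuous_fderiv3_newtonReg δ).comp (continuous_const.sub continuous_id)).clm_apply
        continuous_const).aestronglyMeasurable
  · rw [norm_sub_rev y c]
    calc ‖evalDiag (w y) (fderiv ℝ (fderiv ℝ (fderiv ℝ (newtonReg δ))) (c - y) e)‖
        ≤ ‖evalDiag (w y)‖ * ‖fderiv ℝ (fderiv ℝ (fderiv ℝ (newtonReg δ))) (c - y) e‖ :=
          ContinuousLinearMap.le_opNorm _ _
      _ ≤ ‖w y‖ ^ 2 * (C * ((1 + ‖c - y‖) ^ 4)⁻¹ * ‖e‖) := by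
          refine mul_le_mul (norm_evalDiag_le _) ?_ (norm_nonneg _) (by positivity)
          exact (ContinuousLinearMap.le_opNorm _ _).trans
            (mul_le_mul_of_nonneg_right (hC _) (norm_nonneg _))
      _ = C * ‖e‖ * (((1 + ‖c - y‖) ^ 4)⁻¹ * ‖w y‖ ^ 2) := by ring

/-- **Continuity of the `D³Φ_δ`-pairing** `c ↦ ∫ D³Φ_δ(c - y)(e)(w y, w y) dy` for a uniformly
locally `L²` field `w` (dominated convergence with the weight `(1 + |y - c₀|)⁻⁴ |w|²`).
[folklore] -/
theorem continuous_integral_evalDiag_fderiv3_newtonReg (e : (EuclideanSpace ℝ (Fin 3))) :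
    Continuous fun c : (EuclideanSpace ℝ (Fin 3)) => ∫ y, evalDiag (w y)
      (fderiv ℝ (fderiv ℝ (fderiv ℝ (newtonReg δ))) (c - y) e) := by
  obtain ⟨Cw, hCwtop, hCw⟩ := exists_lintegral_mul_inv_one_add_norm_pow_le
  obtain ⟨C, hC0, hC⟩ := exists_norm_fderiv3_newtonReg_le_inv hδ
  refine continuous_iff_continuousAt.2 fun c₀ => ?_
  obtain ⟨hint, -⟩ := integrable_inv_one_add_norm_pow_mul_norm_sq hCwtop hCw hw hAtop hA c₀
  refine continuousAt_of_dominated (bound := fun y => C * ‖e‖ * 16 *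
    (((1 + ‖y - c₀‖) ^ 4)⁻¹ * ‖w y‖ ^ 2)) ?_ ?_ (hint.const_mul _) ?_
  · exact Eventually.of_forall fun c => aestronglyMeasurable_evalDiag_apply hw
      (((continuous_fderiv3_newtonReg δ).comp (continuous_const.sub continuous_id)).clm_apply
        continuous_const).aestronglyMeasurable
  · filter_upwards [closedBall_mem_nhds c₀ one_pos] with c hc
    refine Eventually.of_forall fun y => ?_
    have hcmp : ((1 + ‖c - y‖) ^ 4)⁻¹ ≤ 16 * ((1 + ‖c₀ - y‖) ^ 4)⁻¹ :=
      inv_one_add_norm_pow_le_of_dist_le (x₀ := y) (y := c) (z := c₀)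
        (by rw [dist_comm]; exact mem_closedBall.1 hc)
    rw [norm_sub_rev y c₀]
    calc ‖evalDiag (w y) (fderiv ℝ (fderiv ℝ (fderiv ℝ (newtonReg δ))) (c - y) e)‖
        ≤ ‖evalDiag (w y)‖ * ‖fderiv ℝ (fderiv ℝ (fderiv ℝ (newtonReg δ))) (c - y) e‖ :=
          ContinuousLinearMap.le_opNorm _ _
      _ ≤ ‖w y‖ ^ 2 * (C * (16 * ((1 + ‖c₀ - y‖) ^ 4)⁻¹) * ‖e‖) := by
          refine mul_le_mul (norm_evalDiag_le _) ?_ (norm_nonneg _) (by positivity)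
          refine (ContinuousLinearMap.le_opNorm _ _).trans (mul_le_mul_of_nonneg_right ?_ (norm_nonneg _))
          exact (hC _).trans (mul_le_mul_of_nonneg_left hcmp hC0)
      _ = C * ‖e‖ * 16 * (((1 + ‖c₀ - y‖) ^ 4)⁻¹ * ‖w y‖ ^ 2) := by ring
  · refine Eventually.of_forall fun y => ?_
    exact ((evalDiag (w y)).continuous.comp ((((continuous_fderiv3_newtonReg δ).comp
      (continuous_id.sub continuous_const)).clm_apply continuous_const))).continuousAt

/-- **The renormalised potential is integrable**: `y ↦ (D²Φ_δ(c - y) - D²Φ_δ(x₀ - y))(w y, w y)`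
is integrable for a uniformly locally `L²` field (the difference of kernels is
`O(|c - x₀| |y|⁻⁴)`). [folklore] -/
theorem integrable_evalDiag_fderiv2_newtonReg_sub (x₀ c : (EuclideanSpace ℝ (Fin 3))) :
    Integrable (fun y => evalDiag (w y)
      (fderiv ℝ (fderiv ℝ (newtonReg δ)) (c - y) - fderiv ℝ (fderiv ℝ (newtonReg δ)) (x₀ - y)))
      volume := by
  obtain ⟨Cw, hCwtop, hCw⟩ := exists_lintegral_mul_inv_one_add_norm_pow_le
  obtain ⟨C, hC0, hC⟩ := exists_norm_fderiv3_newtonReg_le_inv hδ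
  obtain ⟨hint, -⟩ := integrable_inv_one_add_norm_pow_mul_norm_sq hCwtop hCw hw hAtop hA x₀
  have hcont : Continuous fun y : (EuclideanSpace ℝ (Fin 3)) =>
      fderiv ℝ (fderiv ℝ (newtonReg δ)) (c - y) - fderiv ℝ (fderiv ℝ (newtonReg δ)) (x₀ - y) :=
    ((contDiff_fderiv2_newtonReg δ).continuous.comp (continuous_const.sub continuous_id)).sub
      ((contDiff_fderiv2_newtonReg δ).continuous.comp (continuous_const.sub continuous_id))
  refine Integrable.mono' (hint.const_mul (C * ‖c - x₀‖ * (1 + ‖c - x₀‖) ^ 4)) ?_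
    (Eventually.of_forall fun y => ?_)
  · exact aestronglyMeasurable_evalDiag_apply hw hcont.aestronglyMeasurable
  · calc ‖evalDiag (w y) (fderiv ℝ (fderiv ℝ (newtonReg δ)) (c - y) -
          fderiv ℝ (fderiv ℝ (newtonReg δ)) (x₀ - y))‖
        ≤ ‖evalDiag (w y)‖ * ‖fderiv ℝ (fderiv ℝ (newtonReg δ)) (c - y) -
          fderiv ℝ (fderiv ℝ (newtonReg δ)) (x₀ - y)‖ := ContinuousLinearMap.le_opNorm _ _
      _ ≤ ‖w y‖ ^ 2 * (C * ‖c - x₀‖ * (1 + ‖c - x₀‖) ^ 4 * ((1 + ‖y - x₀‖) ^ 4)⁻¹) :=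
          mul_le_mul (norm_evalDiag_le _) (norm_fderiv2_newtonReg_sub_sub_le hC0 hC x₀ c y)
            (norm_nonneg _) (by positivity)
      _ = C * ‖c - x₀‖ * (1 + ‖c - x₀‖) ^ 4 * (((1 + ‖y - x₀‖) ^ 4)⁻¹ * ‖w y‖ ^ 2) := by ring

/-- **Differentiating the renormalised potential under the integral sign.** For a uniformly
locally `L²` field `w` and `δ > 0`, the renormalised potential
`𝒢(c) = ∫ (D²Φ_δ(c - y) - D²Φ_δ(x₀ - y))(w y, w y) dy` has the Fréchet derivative
`∫ evalDiag(w y) ∘ D³Φ_δ(c₀ - y) dy` at every `c₀` (dominated convergence: `‖D³Φ_δ(c - y)‖ ≤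
16 C (1 + |y - c₀|)⁻⁴` for `|c - c₀| ≤ 1`). [folklore] -/
theorem hasFDerivAt_integral_evalDiag_fderiv2_newtonReg_sub (x₀ c₀ : (EuclideanSpace ℝ (Fin 3))) :
    HasFDerivAt (fun c : (EuclideanSpace ℝ (Fin 3)) => ∫ y, evalDiag (w y)
        (fderiv ℝ (fderiv ℝ (newtonReg δ)) (c - y) - fderiv ℝ (fderiv ℝ (newtonReg δ)) (x₀ - y)))
      (∫ y, (evalDiag (w y)).comp (fderiv ℝ (fderiv ℝ (fderiv ℝ (newtonReg δ))) (c₀ - y))) c₀ := by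
  obtain ⟨Cw, hCwtop, hCw⟩ := exists_lintegral_mul_inv_one_add_norm_pow_le
  obtain ⟨C, hC0, hC⟩ := exists_norm_fderiv3_newtonReg_le_inv hδ
  obtain ⟨hint, -⟩ := integrable_inv_one_add_norm_pow_mul_norm_sq hCwtop hCw hw hAtop hA c₀
  have h2c : Continuous (fderiv ℝ (fderiv ℝ (newtonReg δ))) := (contDiff_fderiv2_newtonReg δ).continuous
  have h2d : Differentiable ℝ (fderiv ℝ (fderiv ℝ (newtonReg δ))) :=
    (contDiff_fderiv2_newtonReg δ).differentiable (by norm_num)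
  have hfd3 : ∀ p, fderiv ℝ (fderiv ℝ (fderiv ℝ (newtonReg δ))) p =
      fderiv ℝ (fderiv ℝ (fderiv ℝ (newtonReg δ))) p := fun _ => rfl
  refine hasFDerivAt_integral_of_dominated_of_fderiv_le
    (F' := fun c y => (evalDiag (w y)).comp (fderiv ℝ (fderiv ℝ (fderiv ℝ (newtonReg δ))) (c - y)))
    (bound := fun y => C * 16 * (((1 + ‖y - c₀‖) ^ 4)⁻¹ * ‖w y‖ ^ 2))
    (closedBall_mem_nhds c₀ one_pos) ?_ ?_ ?_ ?_ (hint.const_mul _) ?_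
  · refine Eventually.of_forall fun c => ?_
    have hcont : Continuous fun y : (EuclideanSpace ℝ (Fin 3)) =>
        fderiv ℝ (fderiv ℝ (newtonReg δ)) (c - y) - fderiv ℝ (fderiv ℝ (newtonReg δ)) (x₀ - y) :=
      (h2c.comp (continuous_const.sub continuous_id)).sub (h2c.comp (continuous_const.sub continuous_id))
    exact aestronglyMeasurable_evalDiag_apply hw hcont.aestronglyMeasurable
  · exact integrable_evalDiag_fderiv2_newtonReg_sub hδ hw hAtop hA x₀ c₀
  · exact aestronglyMeasurable_evalDiag_comp_clm hw
      ((continuous_fderiv3_newtonReg δ).comp (continuous_const.sub continuous_id)).aestronglyMeasurable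
  · refine Eventually.of_forall fun y c hc => ?_
    have hcmp : ((1 + ‖c - y‖) ^ 4)⁻¹ ≤ 16 * ((1 + ‖c₀ - y‖) ^ 4)⁻¹ :=
      inv_one_add_norm_pow_le_of_dist_le (x₀ := y) (y := c) (z := c₀)
        (by rw [dist_comm]; exact mem_closedBall.1 hc)
    rw [norm_sub_rev y c₀]
    calc ‖(evalDiag (w y)).comp (fderiv ℝ (fderiv ℝ (fderiv ℝ (newtonReg δ))) (c - y))‖
        ≤ ‖evalDiag (w y)‖ * ‖fderiv ℝ (fderiv ℝ (fderiv ℝ (newtonReg δ))) (c - y)‖ :=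
          ContinuousLinearMap.opNorm_comp_le _ _
      _ ≤ ‖w y‖ ^ 2 * (C * (16 * ((1 + ‖c₀ - y‖) ^ 4)⁻¹)) :=
          mul_le_mul (norm_evalDiag_le _) ((hC _).trans (mul_le_mul_of_nonneg_left hcmp hC0))
            (norm_nonneg _) (by positivity)
      _ = C * 16 * (((1 + ‖c₀ - y‖) ^ 4)⁻¹ * ‖w y‖ ^ 2) := by ring
  · refine Eventually.of_forall fun y c _ => ?_
    have h1 : HasFDerivAt (fun c : (EuclideanSpace ℝ (Fin 3)) => fderiv ℝ (fderiv ℝ (newtonReg δ)) (c - y))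
        (fderiv ℝ (fderiv ℝ (fderiv ℝ (newtonReg δ))) (c - y)) c := by
      have := (h2d (c - y)).hasFDerivAt.comp c (hasFDerivAt_sub_const y)
      rwa [ContinuousLinearMap.comp_id] at this
    exact ((evalDiag (w y)).hasFDerivAt.comp c h1).sub_const _

/-- **The directional derivatives of the renormalised potential** are the `D³Φ_δ`-pairings:
`∂_e 𝒢(c) = ∫ D³Φ_δ(c - y)(e)(w y, w y) dy`. [folklore] -/
theorem fderiv_integral_evalDiag_fderiv2_newtonReg_sub_apply (x₀ c e : (EuclideanSpace ℝ (Fin 3))) :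
    fderiv ℝ (fun c : (EuclideanSpace ℝ (Fin 3)) => ∫ y, evalDiag (w y)
        (fderiv ℝ (fderiv ℝ (newtonReg δ)) (c - y) - fderiv ℝ (fderiv ℝ (newtonReg δ)) (x₀ - y)))
      c e = ∫ y, evalDiag (w y) (fderiv ℝ (fderiv ℝ (fderiv ℝ (newtonReg δ))) (c - y) e) := by
  rw [(hasFDerivAt_integral_evalDiag_fderiv2_newtonReg_sub hδ hw hAtop hA x₀ c).fderiv,
    ContinuousLinearMap.integral_apply]
  · rfl
  · obtain ⟨Cw, hCwtop, hCw⟩ := exists_lintegral_mul_inv_one_add_norm_pow_le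
    obtain ⟨C, hC0, hC⟩ := exists_norm_fderiv3_newtonReg_le_inv hδ
    obtain ⟨hint, -⟩ := integrable_inv_one_add_norm_pow_mul_norm_sq hCwtop hCw hw hAtop hA c
    refine Integrable.mono' (hint.const_mul C) ?_ (Eventually.of_forall fun y => ?_)
    · exact aestronglyMeasurable_evalDiag_comp_clm hw
        ((continuous_fderiv3_newtonReg δ).comp (continuous_const.sub continuous_id)).aestronglyMeasurable
    · rw [norm_sub_rev y c]
      calc ‖(evalDiag (w y)).comp (fderiv ℝ (fderiv ℝ (fderiv ℝ (newtonReg δ))) (c - y))‖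
          ≤ ‖evalDiag (w y)‖ * ‖fderiv ℝ (fderiv ℝ (fderiv ℝ (newtonReg δ))) (c - y)‖ :=
            ContinuousLinearMap.opNorm_comp_le _ _
        _ ≤ ‖w y‖ ^ 2 * (C * ((1 + ‖c - y‖) ^ 4)⁻¹) :=
            mul_le_mul (norm_evalDiag_le _) (hC _) (norm_nonneg _) (by positivity)
        _ = C * (((1 + ‖c - y‖) ^ 4)⁻¹ * ‖w y‖ ^ 2) := by ring

end Parametric

/-! ## Pointwise calculus: pure second derivatives, the pressure kernel off the ball -/

section Pointwise

variable {δ : ℝ}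

/-- The diagonal of the Hessian is the pure second derivative:
`D²Φ_δ(z)(a, a) = ∂ₐ∂ₐΦ_δ(z)`. [folklore] -/
theorem fderiv2_newtonReg_apply_self (z a : (EuclideanSpace ℝ (Fin 3))) :
    fderiv ℝ (fderiv ℝ (newtonReg δ)) z a a =
      fderiv ℝ (fun s => fderiv ℝ (newtonReg δ) s a) z a := by
  have hd : DifferentiableAt ℝ (fderiv ℝ (newtonReg δ)) z :=
    (((contDiff_newtonReg δ (n := 2)).fderiv_right (m := 1) le_rfl).differentiable one_ne_zero) z
  rw [FluidPDE.fderiv_apply_const_apply hd]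

/-- **The third derivative on the diagonal is a directional derivative of a pure second
derivative:** `D³Φ_δ(z)(e)(a, a) = ∂ₑ(∂ₐ∂ₐΦ_δ)(z)` (the form in which the Calderón–Zygmund bound
`exists_eLpNorm_hessConv_le_of_bdd` of the tree is stated). [folklore] -/
theorem fderiv3_newtonReg_apply_apply_self (z e a : (EuclideanSpace ℝ (Fin 3))) :
    fderiv ℝ (fderiv ℝ (fderiv ℝ (newtonReg δ))) z e a a =
      fderiv ℝ (fun s => fderiv ℝ (fun r => fderiv ℝ (newtonReg δ) r a) s a) z e := by
  have hd2 : Differentiable ℝ (fderiv ℝ (fderiv ℝ (newtonReg δ))) :=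
    (contDiff_fderiv2_newtonReg δ).differentiable (by norm_num)
  have hfun : (fun s => fderiv ℝ (fun r => fderiv ℝ (newtonReg δ) r a) s a) =
      fun s => evalDiag a (fderiv ℝ (fderiv ℝ (newtonReg δ)) s) := by
    funext s
    rw [evalDiag_apply, fderiv2_newtonReg_apply_self]
  have hcomp : HasFDerivAt (fun s => evalDiag a (fderiv ℝ (fderiv ℝ (newtonReg δ)) s))
      ((evalDiag a).comp (fderiv ℝ (fderiv ℝ (fderiv ℝ (newtonReg δ))) z)) z :=
    (evalDiag a).hasFDerivAt.comp z (hd2 z).hasFDerivAt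
  rw [hfun, hcomp.fderiv]
  rfl

/-- **Off the closed ball of radius `δ`, the Hessian of `Φ_δ` is minus the pressure kernel on
the diagonal:** `D²Φ_δ(z)(a, a) = -K(z)(a)` for `δ < |z|` (`Φ_δ = Γ` there and
`∂ₐ∂ₐΓ = -K(·)(a)`). [folklore] -/
theorem fderiv2_newtonReg_apply_self_eq_neg_pressureKernel (hδ : 0 < δ) {z : (EuclideanSpace ℝ (Fin 3))} (hz : δ < ‖z‖)
    (a : (EuclideanSpace ℝ (Fin 3))) : fderiv ℝ (fderiv ℝ (newtonReg δ)) z a a = -pressureKernel z a := by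
  rw [fderiv2_newtonReg_apply_self, fderiv_fderiv_newtonReg_apply_eq_neg_pressureKernel hδ hz]

/-- The off-ball identity in two-centre form, as it enters the far field of the local pressure
expansion: for `δ < |c - y|` and `δ < |x₀ - y|`,
`(D²Φ_δ(c - y) - D²Φ_δ(x₀ - y))(a, a) = -(K(c - y)(a) - K(x₀ - y)(a))`. [folklore] -/
theorem evalDiag_fderiv2_newtonReg_sub_eq (hδ : 0 < δ) {c x₀ y : (EuclideanSpace ℝ (Fin 3))} (hc : δ < ‖c - y‖)
    (hx₀ : δ < ‖x₀ - y‖) (a : (EuclideanSpace ℝ (Fin 3))) :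
    evalDiag a (fderiv ℝ (fderiv ℝ (newtonReg δ)) (c - y) - fderiv ℝ (fderiv ℝ (newtonReg δ)) (x₀ - y)) =
      -(pressureKernel (c - y) a - pressureKernel (x₀ - y) a) := by
  rw [evalDiag_apply, _root_.sub_apply, _root_.sub_apply,
    fderiv2_newtonReg_apply_self_eq_neg_pressureKernel hδ hc,
    fderiv2_newtonReg_apply_self_eq_neg_pressureKernel hδ hx₀]
  ring

end Pointwise

end Literature.Analysis.FluidPDE
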